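import Literature.AlgebraicGeometry.Motives.SeesawRelativeChartRepr
import Literature.AlgebraicGeometry.Motives.SeesawRelativeChartLink
import Literature.AlgebraicGeometry.Motives.SeesawRelativeSubschemeGlobal
import Literature.AlgebraicGeometry.Motives.SeesawIdealGluing
import Literature.AlgebraicGeometry.Motives.SeesawRelativeTrivFromBaseLocal
import HarnessLib

/-!
# RELATIVE EDITION (ring base `R`) — The seesaw closed subscheme: a finite basic-open subcover of charts, the glued ideal, and `N1cLocal`

RELATIVE EDITION of ★ `Motives/SeesawChartCover` + head ★ `Motives/SeesawSubscheme` (port map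
`B-provers/B-p08/g11/PORTMAP-h8-RelativeSeesaw.B-p08g11.md`, file R10; cell `hodgecm-mathlib`, F-DAG §5b hand (h8), author B-p08 (g11)):
`SchemeOver ℂ ↦ SchemeOver R`, Stein as the hypothesis `hSt : UnivStein X`; the representing-module inputs `H0Repr`/`DualRepr` are
taken LOCALLY for the given `(X, W, 𝓕)` (`hX : ∀ U, H0Repr X 𝓕 U ∧ DualRepr X 𝓕 U h𝓕`), so that the HEAD
**`exists_seesawSubscheme_of_repr`** — THE RELATIVE SCHEME-THEORETIC SEESAW over an affine base ring, MODULO the relative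
Grothendieck-complex representabilities of ONE family — can be fed by an engine proved for a sub-class (abelian schemes);
namespace `Literature.AlgebraicGeometry.Motives.SeesawRelative`.  HC_CM is proved only modulo the 7 printed citations until rung 0
closes.  Original module docstring (with `ℂ` read as `R`):


[MumfordAV1970] §10 (p. 89) / [GortzWedhorn2023] Thm. 24.66, end of the LOCAL half: on an affine open `U ⊆ W` with ring
`A = Γ(W, U)`, the charts at every prime (`exists_chartProp_at` of `SeesawChartRepr`) give a finite basic-open subcover
`D(f₁), …, D(f_n)` with ideals `J_i ⊆ A_{f_i}` representing `Triv` on `A_{f_i}`-algebras; `Triv` is stable under base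
change and Zariski-local (`SeesawChartLink`), so the ideals glue (★ `SeesawIdealGluing.exists_ideal_forall_triv_iff`)
to ONE ideal `J ⊆ A` with `Triv X 𝓕 U B ↔ J·B = 0` for every `A`-algebra `B`, i.e. (`isReprIdeal_of_forall_triv_iff`)
a representing ideal: **`exists_isReprIdeal`**, hence `n1cLocal_of_repr : … → N1cLocal` and, with the global half
(`SeesawSubschemeGlobal`), `exists_seesawSubscheme_of_repr` — the seesaw closed subscheme for ALL test schemes `S/ℂ`,
with the representing modules `H0Repr`/`DualRepr` as the only remaining hypotheses (`N1cDelta` is ★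
`n1cDelta_holds`; the fibre inputs and the base change of the pairing are ★ `SeesawChartFibreCyclic`).
(Cell `hodgecm-mathlib`, M13 node N1, file S8 of the split plan; HOME certificate `B-plan/m13-glue/N1-Assembly.v9.B-p01g12.lean`
164baf9abb46c288 PART III §16 — decls token-identical except that every v9 hypothesis with a ★ provider (`idealGluing`,
`N1cDelta`, bricks, fibre statements) is discharged by name; heads renamed `…_of_repr`.)

## References
* [MumfordAV1970] D. Mumford, *Abelian Varieties* (1970), §10 p. 89.
* [GortzWedhorn2023] U. Görtz, T. Wedhorn, *Algebraic Geometry II* (2023), Thm. 24.66 (p. 405; proof pp. 407–408).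
-/

set_option autoImplicit false

noncomputable section

-- `TopCat.Presheaf`/`Scheme.Modules` are not reducible (as in Mathlib's `AlgebraicGeometry/Modules`).
set_option backward.isDefEq.respectTransparency false

open CategoryTheory CategoryTheory.Limits AlgebraicGeometry MonoidalCategory CartesianMonoidalCategory
  Opposite
open scoped TensorProduct

namespace Literature.AlgebraicGeometry.Motives

namespace SeesawRelative

open Literature.AlgebraicGeometry.Modules

variable {R : Type} [CommRing R] (X : SchemeOver R) {W : SchemeOver R} (𝓕 : (X ⊗ W).left.Modules)
  (U : W.left.affineOpens)


section Charts

variable {X 𝓕 U}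

/-! ## A finite basic-open subcover, the glued ideal, and `N1cLocal` -/

/-- A chart representability on `A_f`-algebras in the `compAlgebra` shape gives it for every COMPATIBLE pair of
algebra structures (the binder shape of the gluing theorem). [cite: MumfordAV1970, §10 (p. 89)] -/
theorem ChartProp.of_isScalarTower {f : Γ(W.left, U)} {J : Ideal (Localization.Away f)}
    (h : SeesawRelative.ChartProp (X := X) (𝓕 := 𝓕) f J) (B : Type) [CommRing B] [inst : Algebra Γ(W.left, U) B]
    [Algebra (Localization.Away f) B] [IsScalarTower Γ(W.left, U) (Localization.Away f) B] :
    Triv X 𝓕 U B ↔ J.map (algebraMap (Localization.Away f) B) = ⊥ := by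
  have hinst : inst = compAlgebra U f B :=
    Algebra.algebra_ext _ _ fun a => IsScalarTower.algebraMap_apply Γ(W.left, U) (Localization.Away f) B a
  subst hinst
  exact h B

/-- A TOTAL family of chart ideals (`⊤` where no chart is known; non-Prop bookkeeping). [folklore] -/
def chartIdeal (f : Γ(W.left, U)) : Ideal (Localization.Away f) := by
  classical
  exact if h : ∃ J, ChartProp (X := X) (𝓕 := 𝓕) f J then Classical.choose h else ⊤

/-- `chartIdeal f` is a chart ideal whenever one exists. [cite: MumfordAV1970, §10 (p. 89)] -/
theorem chartProp_chartIdeal {f : Γ(W.left, U)} (h : ∃ J, SeesawRelative.ChartProp (X := X) (𝓕 := 𝓕) f J) :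
    ChartProp (X := X) (𝓕 := 𝓕) f (chartIdeal (X := X) (𝓕 := 𝓕) f) := by
  classical
  unfold chartIdeal
  rw [dif_pos h]
  exact Classical.choose_spec h

/-- **THE AFFINE-LOCAL SEESAW IDEAL EXISTS** ([MumfordAV1970] §10 p. 89): charts at every
prime (`exists_chartProp_at`) ⇒ a finite basic-open subcover ⇒ the glued ideal (★ `exists_ideal_forall_triv_iff`, with
(M0) `Triv.of_isScalarTower` and (M0′) `Triv.of_away_cover`) represents `Triv` on all `A`-algebras ⇒ (§11)
it is the representing ideal `IsReprIdeal`. [cite: MumfordAV1970, §10 (p. 89)]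
[cite: GortzWedhorn2023, Thm. 24.66, proof (pp. 407–408)] -/
theorem exists_isReprIdeal_of_repr [GeometricallyIntegral X.hom] (hSt : SeesawRelative.UnivStein X) [𝓕.IsQuasicoherent]
    (h𝓕 : HasRank 𝓕 1) (hR : H0Repr X 𝓕 U) (hR' : DualRepr X 𝓕 U h𝓕) :
    ∃ J : Ideal Γ(W.left, U), IsReprIdeal X 𝓕 U J := by
  classical
  choose f hf hJ using fun 𝔭 : PrimeSpectrum Γ(W.left, U) =>
    exists_chartProp_at hSt h𝓕 hR hR' 𝔭
  -- the basic opens `D(f_𝔭)` cover `Spec A`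
  have hspan : Ideal.span (Set.range f) = ⊤ := by
    by_contra hne
    obtain ⟨𝔪, h𝔪, hle⟩ := Ideal.exists_le_maximal _ hne
    exact hf ⟨𝔪, h𝔪.isPrime⟩ (hle (Ideal.subset_span ⟨_, rfl⟩))
  -- a finite subcover
  obtain ⟨t, ht, hspan_t⟩ : ∃ t : Finset Γ(W.left, U), ↑t ⊆ Set.range f ∧ Ideal.span (t : Set Γ(W.left, U)) = ⊤ := by
    have h1 : (1 : Γ(W.left, U)) ∈ Ideal.span (Set.range f) := hspan ▸ Submodule.mem_top
    obtain ⟨t, ht, h1t⟩ := Submodule.mem_span_finite_of_mem_span h1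
    exact ⟨t, ht, (Ideal.eq_top_iff_one _).mpr h1t⟩
  -- glue
  obtain ⟨J, hJiff⟩ := SeesawSubscheme.exists_ideal_forall_triv_iff (fun B _ _ => Triv X 𝓕 U B) t
    (fun g => chartIdeal (X := X) (𝓕 := 𝓕) g)
    (fun g hg B _ _ _ _ => by
      obtain ⟨𝔭, rfl⟩ := ht hg
      exact (chartProp_chartIdeal (hJ 𝔭)).of_isScalarTower B)
    (fun B _ _ C _ _ _ _ hB => Triv.of_isScalarTower X 𝓕 U B C hB)
    (fun B _ _ s hs h => Triv.of_away_cover X 𝓕 U n1cDelta_holds hSt h𝓕 B s hs h) hspan_t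
  exact ⟨J, isReprIdeal_of_forall_triv_iff X 𝓕 U J hJiff⟩

end Charts

end SeesawRelative

namespace SeesawRelative

open Literature.AlgebraicGeometry.Modules

/-- **THE RELATIVE SEESAW CLOSED SUBSCHEME from the per-chart inputs** — global half ★
`exists_seesawSubscheme_of_sockets` (relative) composed with `exists_isReprIdeal_of_repr` on every affine open and ★
`n1cDelta_holds` (relative): for `X → Spec R` geometrically integral and universally Stein, `W → Spec R` locally of finite type,
`𝓕` quasi-coherent of rank one on `X ×_R W` whose chart functors `H⁰(𝓕_B)`, `Hom(𝓕_B, 𝒪)` are represented on every affine open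
(`hX`, the relative Grothendieck-complex input), there is a closed subscheme `Z ↪ W` such that ANY `u : S → W` over `R` factors
through `Z` iff `(1 × u)^*𝓕 ≅ pr_S^*𝓜` for an invertible quasi-coherent `𝓜` on `S` ([MumfordAV1970] §10 p. 89 over a ring base;
[GortzWedhorn2023] Thm. 24.66). [cite: MumfordAV1970, §10 (p. 89)] [cite: GortzWedhorn2023, Thm. 24.66 (p. 405; proof pp. 407–408)] -/
theorem exists_seesawSubscheme_of_repr {R : Type} [CommRing R] (X : SchemeOver R) [GeometricallyIntegral X.hom]
    (hSt : SeesawRelative.UnivStein X) (W : SchemeOver R) [LocallyOfFiniteType W.hom] (𝓕 : (X ⊗ W).left.Modules) [𝓕.IsQuasicoherent] (h𝓕 : HasRank 𝓕 1)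
    (hX : ∀ U : W.left.affineOpens, H0Repr X 𝓕 U ∧ DualRepr X 𝓕 U h𝓕) :
    ∃ (Z : SchemeOver R) (i : Z ⟶ W) (_ : IsClosedImmersion i.left),
      ∀ (S : SchemeOver R) (u : S ⟶ W),
        (∃ v : S ⟶ Z, v ≫ i = u) ↔
          ∃ (𝓜 : S.left.Modules) (_ : 𝓜.IsQuasicoherent) (_ : HasRank 𝓜 1),
            Nonempty ((Scheme.Modules.pullback (X ◁ u).left).obj 𝓕 ≅
              (Scheme.Modules.pullback (CartesianMonoidalCategory.snd X S).left).obj 𝓜) :=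
  exists_seesawSubscheme_of_sockets X hSt W 𝓕 h𝓕
    (fun U => exists_isReprIdeal_of_repr (X := X) (𝓕 := 𝓕) (U := U) hSt h𝓕 (hX U).1 (hX U).2) n1cDelta_holds

/-- The same in rank-one currency (no quasi-coherence binder on `𝓜`: a module of constant rank is quasi-coherent,
★ `isQuasicoherent_of_hasRank`) — the relative twin of ★ `SeesawSubscheme.exists_seesawSubscheme'`.
[cite: MumfordAV1970, §10 (p. 89)] [cite: GortzWedhorn2023, Thm. 24.66 (p. 405; proof pp. 407–408)] -/
theorem exists_seesawSubscheme_of_repr' {R : Type} [CommRing R] (X : SchemeOver R) [GeometricallyIntegral X.hom]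
    (hSt : SeesawRelative.UnivStein X) (W : SchemeOver R) [LocallyOfFiniteType W.hom] (𝓕 : (X ⊗ W).left.Modules) (h𝓕 : HasRank 𝓕 1)
    (hX : ∀ U : W.left.affineOpens, H0Repr X 𝓕 U ∧ DualRepr X 𝓕 U h𝓕) :
    ∃ (Z : SchemeOver R) (i : Z ⟶ W) (_ : IsClosedImmersion i.left),
      ∀ (S : SchemeOver R) (u : S ⟶ W),
        (∃ v : S ⟶ Z, v ≫ i = u) ↔
          ∃ (𝓜 : S.left.Modules) (_ : HasRank 𝓜 1),
            Nonempty ((Scheme.Modules.pullback (X ◁ u).left).obj 𝓕 ≅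
              (Scheme.Modules.pullback (CartesianMonoidalCategory.snd X S).left).obj 𝓜) := by
  haveI : 𝓕.IsQuasicoherent := isQuasicoherent_of_hasRank h𝓕
  obtain ⟨Z, i, hi, hZ⟩ := exists_seesawSubscheme_of_repr X hSt W 𝓕 h𝓕 hX
  refine ⟨Z, i, hi, fun S u => (hZ S u).trans ⟨?_, ?_⟩⟩
  · rintro ⟨𝓜, -, h1, e⟩
    exact ⟨𝓜, h1, e⟩
  · rintro ⟨𝓜, h1, e⟩
    exact ⟨𝓜, isQuasicoherent_of_hasRank h1, h1, e⟩

end SeesawRelative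

end Literature.AlgebraicGeometry.Motives

end
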